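import Mathlib
import Summits.ValiantsHypothesis.ValiantsHypothesis.Theorems.RigidityForcesSymmetryRankRigidMinimalReprLaplaceFourFivePencil

/-!
# The `5 × 5` pencil: a plane is never inside the fifteen lines
# (crux `RankRigidMinimalRepr`, stmt-ValiantsHypothesis-18034; frontier rung `LaplaceOptimalFive`, stmt-24813)

Companion of `…LaplaceFourFivePencil.lean` (`Pencil5.pencil5_two_rank_one`: if the pencil `M(t)(z,w) = [z ≠ w](T - t_z - t_w)` is a
sum of two rank-one products then `t` lies on one of FIFTEEN lines — five stars `𝟙 - 3e_a`, ten matchings `e_a - e_b`), the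
one-letter-up twin of `LaplaceFourPencil.pencil_plane_not_two_rank_one`:

* `pencil5_plane_not_two_rank_one` — if `t, t'` are linearly independent, the matrices `M(t + μ t')` cannot ALL (`μ ∈ ℂ`) be sums of
  two rank-one products: each `t + μ t'` would lie on one of the fifteen lines, two of the thirty-one values `μ = 0, …, 30` would share a
  line, and a line through two points of the pencil `t + μ t'` contains `t` and `t'`.

Use (`…LaplaceThreeFiveSliceRank.lean`): the `3 × 5` injective pattern has slice rank exactly `5`.  HONEST FRAMING: elementary linear
algebra; `LaplaceOptimalFive` (stmt-24813) OPEN; nothing here bears on `VP ≠ VNP`.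
-/

set_option autoImplicit false

-- the mandated summit-side namespace repeats a component by design (single-problem summit)
set_option linter.dupNamespace false

namespace Summit.ValiantsHypothesis.ValiantsHypothesis.Theorems.RigidityForcesSymmetryRankRigidMinimalRepr

namespace Pencil5

open Finset

/-- Descriptor of the fifteen lines: `inl x` = the star at `x`, `inr (x, y)` = the matching `{x, y}`. -/
theorem fifteen_lines_descriptor (t a b a' b' : Fin 5 → ℂ)
    (h : ∀ z w : Fin 5, (if z = w then (0 : ℂ) else (∑ i, t i) - t z - t w) = a z * b w + a' z * b' w) :
    ∃ d : Fin 5 ⊕ (Fin 5 × Fin 5), match d with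
      | Sum.inl x => ∃ c : ℂ, t x = -2 * c ∧ ∀ j, j ≠ x → t j = c
      | Sum.inr p => p.1 ≠ p.2 ∧ (∀ k, k ≠ p.1 → k ≠ p.2 → t k = 0) ∧ t p.1 + t p.2 = 0 := by
  rcases pencil5_two_rank_one t a b a' b' h with ⟨x, c, hx, hj⟩ | ⟨x, y, hxy, h0, hs⟩
  · exact ⟨Sum.inl x, c, hx, hj⟩
  · exact ⟨Sum.inr (x, y), hxy, h0, hs⟩

/-- **No plane inside the fifteen lines.**  If `t, t'` are linearly independent, the pencil matrices `M(t + μ t')` cannot all be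
sums of two rank-one products. -/
theorem pencil5_plane_not_two_rank_one (t t' : Fin 5 → ℂ) (hind : LinearIndependent ℂ ![t, t'])
    (h : ∀ μ : ℂ, ∃ a b a' b' : Fin 5 → ℂ, ∀ z w : Fin 5,
      (if z = w then (0 : ℂ) else (∑ i, (t + μ • t') i) - (t + μ • t') z - (t + μ • t') w) =
        a z * b w + a' z * b' w) : False := by
  rw [LinearIndependent.pair_iff] at hind
  have hdesc : ∀ k : Fin 31, ∃ d : Fin 5 ⊕ (Fin 5 × Fin 5), match d with
      | Sum.inl x => ∃ c : ℂ, (t + ((k : ℕ) : ℂ) • t') x = -2 * c ∧ ∀ j, j ≠ x → (t + ((k : ℕ) : ℂ) • t') j = c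
      | Sum.inr p => p.1 ≠ p.2 ∧ (∀ l, l ≠ p.1 → l ≠ p.2 → (t + ((k : ℕ) : ℂ) • t') l = 0) ∧
          (t + ((k : ℕ) : ℂ) • t') p.1 + (t + ((k : ℕ) : ℂ) • t') p.2 = 0 := by
    intro k
    obtain ⟨a, b, a', b', hk⟩ := h ((k : ℕ) : ℂ)
    exact fifteen_lines_descriptor _ a b a' b' hk
  choose f hf using hdesc
  obtain ⟨k₁, k₂, hne, heq⟩ := Fintype.exists_ne_map_eq_of_card_lt f (by simp)
  have hμ : ((k₁ : ℕ) : ℂ) ≠ ((k₂ : ℕ) : ℂ) := by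
    intro e
    exact hne (Fin.ext (by exact_mod_cast e))
  set μ₁ : ℂ := ((k₁ : ℕ) : ℂ) with hμ₁
  set μ₂ : ℂ := ((k₂ : ℕ) : ℂ) with hμ₂
  have h1 := hf k₁
  have h2 := hf k₂
  rw [heq] at h1
  -- a common line forces a non-trivial linear relation between `t` and `t'`
  have relation : ∀ c₁ c₂ : ℂ, (∀ j, c₂ * (t + μ₁ • t') j - c₁ * (t + μ₂ • t') j = 0) →
      c₁ = c₂ ∧ c₁ = 0 := by
    intro c₁ c₂ hrel
    have hv : (c₂ - c₁) • t + (c₂ * μ₁ - c₁ * μ₂) • t' = 0 := by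
      funext j
      have := hrel j
      simp only [Pi.add_apply, Pi.smul_apply, smul_eq_mul, Pi.zero_apply] at this ⊢
      linear_combination this
    obtain ⟨e1, e2⟩ := hind _ _ hv
    have hc : c₁ = c₂ := by linear_combination -e1
    refine ⟨hc, ?_⟩
    rw [hc] at e2
    have : c₂ * (μ₁ - μ₂) = 0 := by linear_combination e2
    rcases mul_eq_zero.1 this with h0 | h0
    · rw [hc, h0]
    · exact absurd (sub_eq_zero.1 h0) hμ
  have vanish : (∀ j, (t + μ₁ • t') j = 0) → False := by
    intro hv
    have : (1 : ℂ) • t + μ₁ • t' = 0 := by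
      funext j; simpa using hv j
    exact one_ne_zero (hind _ _ this).1
  rcases hd : f k₂ with x | ⟨x, y⟩
  · rw [hd] at h1 h2
    obtain ⟨c₁, hx₁, hj₁⟩ := h1
    obtain ⟨c₂, hx₂, hj₂⟩ := h2
    obtain ⟨hc, hc0⟩ := relation c₁ c₂ (fun j => by
      by_cases hjx : j = x
      · subst hjx; rw [hx₁, hx₂]; ring
      · rw [hj₁ j hjx, hj₂ j hjx]; ring)
    exact vanish fun j => by
      by_cases hjx : j = x
      · subst hjx; rw [hx₁, hc0]; ring
      · rw [hj₁ j hjx, hc0]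
  · rw [hd] at h1 h2
    obtain ⟨hxy, hz₁, hs₁⟩ := h1
    obtain ⟨-, hz₂, hs₂⟩ := h2
    simp only at hxy hz₁ hs₁ hz₂ hs₂
    obtain ⟨hc, hc0⟩ := relation ((t + μ₁ • t') x) ((t + μ₂ • t') x) (fun l => by
      by_cases hlx : l = x
      · subst hlx; ring
      by_cases hly : l = y
      · subst hly
        have e1 : (t + μ₁ • t') l = -(t + μ₁ • t') x := by linear_combination hs₁
        have e2 : (t + μ₂ • t') l = -(t + μ₂ • t') x := by linear_combination hs₂
        rw [e1, e2]; ring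
      · rw [hz₁ l hlx hly, hz₂ l hlx hly]; ring)
    exact vanish fun l => by
      by_cases hlx : l = x
      · subst hlx; exact hc0
      by_cases hly : l = y
      · subst hly; linear_combination hs₁ - hc0
      · exact hz₁ l hlx hly

end Pencil5

end Summit.ValiantsHypothesis.ValiantsHypothesis.Theorems.RigidityForcesSymmetryRankRigidMinimalRepr
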